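import Mathlib
import Literature.AlgebraicGeometry.Resolution.CohenMacaulayCatenary
import Literature.AlgebraicGeometry.Resolution.CatenaryRings
import Summits.Langlands.Langlands.Theorems.SkinnerWilesDefectOneReducibleOrdinaryProModularCohenMacaulayConnectedness
import Literature.RingTheory.LocalCohomology.GrothendieckConnectedness

/-!
# Stub (R) `stub_raynaudConnectedness` ⟸ Grothendieck's connectedness theorem (SGA 2, XIII 2.1)

Route `SkinnerWilesDefectOne`, crux `ReducibleOrdinaryProModular` (stmt-Langlands-12919), line
`fine-selmer-codimension-two`, registered stub (R) `stub_raynaudConnectedness`: for a complete local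
Cohen–Macaulay `A` ("an `A`-regular sequence in `𝔪` of length `dim A`") and `R ≅ A ⧸ I` with
`n + 1 + μ(I) ≤ dim A`, `Spec R` is connected in dimension `n` (crossing form).  Sequel of
`…HartshorneConnectedness.lean`, `…CohenMacaulayConnectedness.lean` (and, for the complete-intersection
case, `…RegularSequenceConnectedness.lean`).

This file pins down EXACTLY what the stub still owes to the literature: it states Grothendieck's
connectedness theorem [SGA 2, Exp. XIII, Théorème 2.1] (read: arXiv:math/0511279, Exp. XIII §2, p. 95 of
the 2005 edition) as a named `Prop` — for a complete Noetherian local ring `A` and `k ≥ 1` such that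
(a_k) every irreducible component of `Spec A ∖ {𝔪}` has dimension `≥ k + 1` (i.e. `dim A/P ≥ k + 2` for
all minimal `P`) and (b_k) `Spec A ∖ {𝔪}` is connected in dimension `≥ k` (i.e. `Spec A` cannot be
disconnected by a closed subset of dimension `≤ k`; crossing form: two minimal primes of different
colours have `dim A/(C₁ + C₂) ≥ k + 1`), and `f₁, …, f_m ∈ 𝔪` with `m ≤ k`, the quotient
`B = A/(f₁, …, f_m)` satisfies (a_{k−m}) and (b_{k−m}) — and DERIVES the registered stub from it:

* `Theorems.GrothendieckConnectedness` — the named fact (statement only; its proof — local Lefschetz /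
  Hartshorne–Lichtenbaum vanishing + Mayer–Vietoris, or Grothendieck's induction via Hartshorne's
  theorem for `(S₂)` hypersurface sections — is not in Mathlib or the tree);
* `Theorems.le_ringKrullDim_quotient_of_height_le` — in a Cohen–Macaulay local ring a prime of height
  `≤ h` has `dim A/P ≥ dim A − h` (so (a_k) holds with `k = dim A − 2`: minimal primes have coheight
  `dim A`);
* `FineSelmerCodimensionTwo.stub_raynaudConnectedness_auxOfSGA2` (registered sub-goal) —
  `GrothendieckConnectedness → stub (R)` verbatim: `n = 0` is the connectedness of a local ring;
  `μ(I) = 0` is `I = 0` (`stub_raynaudConnectedness_auxEqBot`); otherwise `k = dim A − 2 ≥ 1`,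
  (a_k) by the coheight lemma, (b_k) by Hartshorne's "Cohen–Macaulay ⟹ connected in codimension one"
  (`connectedInCodimOne_of_isCohenMacaulay`, PROVED), `m = μ(I) ≤ k`, and (b_{k−m}) is connectedness in
  dimension `dim A − 1 − μ(I) ≥ n`, transported along `R ≃ A ⧸ I ≃ A ⧸ (f₁,…,f_μ)`.

So after this file stub (R) = `GrothendieckConnectedness` + bookkeeping; the complete-intersection
case is unconditional (`stub_raynaudConnectedness_auxRegularSequence`).

References: A. Grothendieck, SGA 2, Exp. XIII, Théorème 2.1 (and Exp. III Cor. 3.9 = Hartshorne)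
[Grothendieck1968SGA2]; M. Brodmann, R. Sharp, *Local cohomology*, CUP 1998, Ch. 19 ("Connectivity in
algebraic varieties": Grothendieck's connectedness theorem, `c(R/𝔞) ≥ min{c(R), sdim R − 1} − ara 𝔞`)
[BrodmannSharp1998]; R. Hartshorne, Amer. J. Math. 84 (1962) [Hartshorne1962]; C. Skinner, A. Wiles,
Publ. Math. IHÉS 89 (1999), App. A, Prop. A.1, Cor. A.2 [SkinnerWiles1999].
-/

set_option linter.dupNamespace false -- project-wide option (lakefile weak.linter.dupNamespace); `Summit.Langlands.Langlands` is the mandated namespace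
set_option autoImplicit false

namespace Summit.Langlands.Langlands.Theorems

open IsLocalRing RingTheory.Sequence

universe u

/-! ## 1. The named fact: Grothendieck's connectedness theorem -/

variable {A : Type u} [CommRing A]

/-- **In a Cohen–Macaulay local ring a prime of height `≤ h` has coheight `≥ dim A − h`** ("an `A`-regular
sequence in `𝔪` of length `dim A`" verbatim; saturated chains have length `dim A`, tree
`length_eq_of_isSaturatedChain_of_isRegular`, Stacks 00N9).  For `h = 0`: minimal primes have coheight
`dim A` (Cohen–Macaulay local rings are equidimensional). [cite: StacksProject, Tag 00N9] -/
theorem le_ringKrullDim_quotient_of_height_le [IsNoetherianRing A] [IsLocalRing A]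
    {rs : List A} (hreg : IsRegular A rs) (hmem : ∀ r ∈ rs, r ∈ maximalIdeal A)
    (hdim : (rs.length : WithBot ℕ∞) = ringKrullDim A)
    (P : PrimeSpectrum A) {h : ℕ} (hP : P.asIdeal.height ≤ h) :
    ((rs.length - h : ℕ) : WithBot ℕ∞) ≤ ringKrullDim (A ⧸ P.asIdeal) := by
  obtain ⟨p₀, hp₀, hp₀P⟩ :=
    Ideal.exists_minimalPrimes_le (show (⊥ : Ideal A) ≤ P.asIdeal from bot_le)
  let P₀ : PrimeSpectrum A := ⟨p₀, hp₀.1.1⟩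
  obtain ⟨s₁, hs₁h, hs₁l, hs₁⟩ := Literature.AlgebraicGeometry.Resolution.exists_isSaturatedChain
    (show P₀ ≤ P from (PrimeSpectrum.asIdeal_le_asIdeal P₀ P).mp hp₀P)
  obtain ⟨s₂, hs₂h, hs₂l, hs₂⟩ := Literature.AlgebraicGeometry.Resolution.exists_isSaturatedChain
    (show P ≤ closedPoint A from
      (PrimeSpectrum.asIdeal_le_asIdeal P (closedPoint A)).mp (IsLocalRing.le_maximalIdeal P.isPrime.ne_top))
  have hconn : s₁.last = s₂.head := by rw [hs₁l, hs₂h]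
  have hlen : (s₁.smash s₂ hconn).length = rs.length :=
    Literature.AlgebraicGeometry.Resolution.length_eq_of_isSaturatedChain_of_isRegular hreg hmem hdim
      (s₁.smash s₂ hconn) (by rw [RelSeries.head_smash, hs₁h]; exact hp₀)
      (by rw [RelSeries.last_smash, hs₂l])
      (Literature.AlgebraicGeometry.Resolution.forall_covBy_smash hconn hs₁ hs₂)
  rw [RelSeries.smash_length] at hlen
  have h1 : s₁.length ≤ h := by
    have h' := Order.length_le_height_last (p := s₁)
    rw [hs₁l, ← PrimeSpectrum.height_eq_orderHeight] at h'
    exact_mod_cast h'.trans hP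
  have h2 : rs.length - h ≤ s₂.length := by omega
  have h3 := LTSeries.length_le_ringKrullDim_quotient_head s₂
  rw [hs₂h] at h3
  exact le_trans (by exact_mod_cast h2) h3

/-- A finite set of generators of cardinality `μ(I)`, as a list: `I = (f₁, …, f_μ)`. [folklore] -/
theorem exists_ofList_eq_of_fg {I : Ideal A} (hI : I.FG) :
    ∃ fs : List A, fs.length = I.spanFinrank ∧ Ideal.ofList fs = I ∧ ∀ f ∈ fs, f ∈ I := by
  obtain ⟨s, hs, hspan⟩ := Submodule.FG.exists_span_finset_card_eq_spanFinrank hI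
  refine ⟨s.toList, by rw [Finset.length_toList, hs], ?_, fun f hf => ?_⟩
  · rw [← hspan, Ideal.ofList]
    congr 1
    ext x
    simp
  · rw [← hspan]
    exact Submodule.subset_span (by simpa using hf)

end Summit.Langlands.Langlands.Theorems

/-! ## 3. The registered sub-goal: stub (R) from `GrothendieckConnectedness` -/

namespace Summit.Langlands.Langlands.Cruxes.ReducibleOrdinaryProModular.FineSelmerCodimensionTwo

open IsLocalRing RingTheory.Sequence Summit.Langlands.Langlands.Theorems

/-- **Registered sub-goal `stub_raynaudConnectedness_auxOfSGA2`: stub (R) `stub_raynaudConnectedness`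
follows from Grothendieck's connectedness theorem** (`Theorems.GrothendieckConnectedness`, SGA 2 XIII 2.1),
the stub's binders verbatim after the hypothesis.  Proof: WLOG `R = A ⧸ I` (`crossing_of_ringEquiv`),
`I ≤ 𝔪` (as `R` has a prime); `n = 0`: a local ring is connected; `μ(I) = 0`: `I = 0` and Hartshorne's
theorem (`stub_raynaudConnectedness_auxEqBot`); else `k = dim A − 2 ≥ 1`, (a_k) from
`le_ringKrullDim_quotient_of_height_le`, (b_k) = `connectedInCodimOne_of_isCohenMacaulay`, `m = μ(I) ≤ k`,
and (b_{k−m}) is connectedness in dimension `dim A − 1 − μ(I) ≥ n`.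
[cite: Grothendieck1968SGA2, Exp. XIII Théorème 2.1] -/
theorem stub_raynaudConnectedness_auxOfSGA2 :
    (∀ (A : Type) [CommRing A] [IsNoetherianRing A] [IsLocalRing A]
        [IsAdicComplete (IsLocalRing.maximalIdeal A) A] (k : ℕ), 1 ≤ k →
        (∀ P : Ideal A, P ∈ minimalPrimes A → ((k + 2 : ℕ) : WithBot ℕ∞) ≤ ringKrullDim (A ⧸ P)) →
        (∀ S : Set (PrimeSpectrum A), (∃ C ∈ S, C.asIdeal ∈ minimalPrimes A) →
          (∃ C ∉ S, C.asIdeal ∈ minimalPrimes A) →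
            ∃ C₁ ∈ S, ∃ C₂ ∉ S, C₁.asIdeal ∈ minimalPrimes A ∧ C₂.asIdeal ∈ minimalPrimes A ∧
              ((k + 1 : ℕ) : WithBot ℕ∞) ≤ ringKrullDim (A ⧸ (C₁.asIdeal ⊔ C₂.asIdeal))) →
        ∀ (fs : List A), (∀ f ∈ fs, f ∈ IsLocalRing.maximalIdeal A) → fs.length ≤ k →
          (∀ Q : Ideal (A ⧸ Ideal.ofList fs), Q ∈ minimalPrimes (A ⧸ Ideal.ofList fs) →
            ((k - fs.length + 2 : ℕ) : WithBot ℕ∞) ≤ ringKrullDim ((A ⧸ Ideal.ofList fs) ⧸ Q)) ∧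
          (∀ S : Set (PrimeSpectrum (A ⧸ Ideal.ofList fs)),
            (∃ C ∈ S, C.asIdeal ∈ minimalPrimes (A ⧸ Ideal.ofList fs)) →
            (∃ C ∉ S, C.asIdeal ∈ minimalPrimes (A ⧸ Ideal.ofList fs)) →
              ∃ C₁ ∈ S, ∃ C₂ ∉ S, C₁.asIdeal ∈ minimalPrimes (A ⧸ Ideal.ofList fs) ∧
                C₂.asIdeal ∈ minimalPrimes (A ⧸ Ideal.ofList fs) ∧
                ((k - fs.length + 1 : ℕ) : WithBot ℕ∞) ≤
                  ringKrullDim ((A ⧸ Ideal.ofList fs) ⧸ (C₁.asIdeal ⊔ C₂.asIdeal)))) →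
    ∀ (R : Type) [CommRing R] (A : Type) [CommRing A] [IsNoetherianRing A] [IsLocalRing A]
      [IsAdicComplete (IsLocalRing.maximalIdeal A) A] (rs : List A),
      (∀ r ∈ rs, r ∈ IsLocalRing.maximalIdeal A) → RingTheory.Sequence.IsRegular A rs →
      (rs.length : WithBot ℕ∞) = ringKrullDim A →
      ∀ (I : Ideal A) (_ : R ≃+* A ⧸ I) (n : ℕ), ((n + 1 : ℕ) : WithBot ℕ∞) + I.spanFinrank ≤ ringKrullDim A →
      ∀ S : Set (PrimeSpectrum R),
        (∃ C ∈ S, C.asIdeal ∈ minimalPrimes R) → (∃ C ∉ S, C.asIdeal ∈ minimalPrimes R) →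
          ∃ C₁ ∈ S, ∃ C₂ ∉ S, C₁.asIdeal ∈ minimalPrimes R ∧ C₂.asIdeal ∈ minimalPrimes R ∧
            (n : WithBot ℕ∞) ≤ ringKrullDim (R ⧸ (C₁.asIdeal ⊔ C₂.asIdeal)) := by
  intro hG R _ A _ _ _ _ rs hmem hreg hdim I e n hle S h₁ h₂
  -- `R` has a prime, so `R ≃ A ⧸ I` is nontrivial and `I ≤ 𝔪`
  have hI : I ≠ ⊤ := by
    obtain ⟨C, -, -⟩ := h₁
    intro hI
    haveI : Subsingleton (A ⧸ I) := Ideal.Quotient.subsingleton_iff.mpr hI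
    haveI : Subsingleton R := e.injective.subsingleton
    exact C.isPrime.ne_top (Subsingleton.elim _ _)
  have hIm : I ≤ maximalIdeal A := IsLocalRing.le_maximalIdeal hI
  haveI : Nontrivial (A ⧸ I) := Ideal.Quotient.nontrivial_iff.mpr hI
  haveI : IsLocalRing (A ⧸ I) :=
    IsLocalRing.of_surjective' (Ideal.Quotient.mk I) Ideal.Quotient.mk_surjective
  -- `n + 1 + μ(I) ≤ dim A = rs.length`
  have hn : n + 1 + I.spanFinrank ≤ rs.length := by
    have h1 := hle.trans_eq hdim.symm
    exact_mod_cast h1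
  refine crossing_of_ringEquiv e n (fun S' h₁' h₂' => ?_) S h₁ h₂
  rcases Nat.eq_zero_or_pos n with rfl | hnpos
  · -- `n = 0`: a local ring is connected
    obtain ⟨C₁, hC₁S, hC₁⟩ := h₁'
    obtain ⟨C₂, hC₂S, hC₂⟩ := h₂'
    refine ⟨C₁, hC₁S, C₂, hC₂S, hC₁, hC₂, ?_⟩
    have hne : C₁.asIdeal ⊔ C₂.asIdeal ≠ ⊤ := fun h => (maximalIdeal.isMaximal (A ⧸ I)).ne_top
      (top_le_iff.mp (h ▸ sup_le (IsLocalRing.le_maximalIdeal C₁.isPrime.ne_top)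
        (IsLocalRing.le_maximalIdeal C₂.isPrime.ne_top)))
    haveI : Nontrivial ((A ⧸ I) ⧸ (C₁.asIdeal ⊔ C₂.asIdeal)) := Ideal.Quotient.nontrivial_iff.mpr hne
    exact_mod_cast ringKrullDim_nonneg_of_nontrivial
  by_cases hμ : I.spanFinrank = 0
  · -- `μ(I) = 0`: `I = 0`, Hartshorne's theorem
    have hI0 : I = ⊥ := (Submodule.spanFinrank_eq_zero_iff_eq_bot (IsNoetherian.noetherian I)).mp hμ
    exact stub_raynaudConnectedness_auxEqBot (A ⧸ I) A rs hmem hreg hdim I (RingEquiv.refl _) n hle hI0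
      S' h₁' h₂'
  -- general case: SGA 2 XIII 2.1 with `k = dim A − 2`, `m = μ(I)`
  obtain ⟨fs, hfsl, hfsI, hfsmem⟩ := exists_ofList_eq_of_fg (IsNoetherian.noetherian I)
  have hk : 1 ≤ rs.length - 2 := by omega
  have hak : ∀ P : Ideal A, P ∈ minimalPrimes A →
      ((rs.length - 2 + 2 : ℕ) : WithBot ℕ∞) ≤ ringKrullDim (A ⧸ P) := by
    intro P hP
    haveI : P.IsPrime := hP.1.1
    have h0 : P.height ≤ 0 := (Ideal.height_eq_zero_iff.mpr hP).le
    have := le_ringKrullDim_quotient_of_height_le hreg hmem hdim ⟨P, hP.1.1⟩ h0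
    rwa [show rs.length - 2 + 2 = rs.length - 0 by omega]
  have hbk : ∀ S : Set (PrimeSpectrum A), (∃ C ∈ S, C.asIdeal ∈ minimalPrimes A) →
      (∃ C ∉ S, C.asIdeal ∈ minimalPrimes A) →
        ∃ C₁ ∈ S, ∃ C₂ ∉ S, C₁.asIdeal ∈ minimalPrimes A ∧ C₂.asIdeal ∈ minimalPrimes A ∧
          ((rs.length - 2 + 1 : ℕ) : WithBot ℕ∞) ≤ ringKrullDim (A ⧸ (C₁.asIdeal ⊔ C₂.asIdeal)) := by
    intro T hT₁ hT₂
    rw [show rs.length - 2 + 1 = rs.length - 1 by omega]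
    exact connectedInCodimOne_of_isCohenMacaulay hreg hmem hdim T hT₁ hT₂
  have hfsm : ∀ f ∈ fs, f ∈ maximalIdeal A := fun f hf => hIm (hfsmem f hf)
  obtain ⟨-, hconn⟩ := hG A (rs.length - 2) hk hak hbk fs hfsm (by omega)
  -- transport `A ⧸ (f₁,…,f_μ) ≃ A ⧸ I` and compare the bounds
  have e' : (A ⧸ I) ≃+* A ⧸ Ideal.ofList fs := Ideal.quotEquivOfEq hfsI.symm
  refine crossing_of_ringEquiv e' n (fun T hT₁ hT₂ => ?_) S' h₁' h₂'
  obtain ⟨C₁, hC₁S, C₂, hC₂S, hC₁, hC₂, hle'⟩ := hconn T hT₁ hT₂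
  refine ⟨C₁, hC₁S, C₂, hC₂S, hC₁, hC₂, le_trans ?_ hle'⟩
  exact_mod_cast (show n ≤ rs.length - 2 - fs.length + 1 by omega)

/-- **Stub (R) from the named fact**: `Theorems.GrothendieckConnectedness` (SGA 2 XIII 2.1) implies the
registered stub `stub_raynaudConnectedness` verbatim (definitional unfolding of
`stub_raynaudConnectedness_auxOfSGA2`). [cite: Grothendieck1968SGA2, Exp. XIII Théorème 2.1] -/
theorem stub_raynaudConnectedness_of_grothendieckConnectedness (hG : Literature.RingTheory.LocalCohomology.GrothendieckConnectedness) :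
    ∀ (R : Type) [CommRing R] (A : Type) [CommRing A] [IsNoetherianRing A] [IsLocalRing A]
      [IsAdicComplete (IsLocalRing.maximalIdeal A) A] (rs : List A),
      (∀ r ∈ rs, r ∈ IsLocalRing.maximalIdeal A) → RingTheory.Sequence.IsRegular A rs →
      (rs.length : WithBot ℕ∞) = ringKrullDim A →
      ∀ (I : Ideal A) (_ : R ≃+* A ⧸ I) (n : ℕ), ((n + 1 : ℕ) : WithBot ℕ∞) + I.spanFinrank ≤ ringKrullDim A →
      ∀ S : Set (PrimeSpectrum R),
        (∃ C ∈ S, C.asIdeal ∈ minimalPrimes R) → (∃ C ∉ S, C.asIdeal ∈ minimalPrimes R) →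
          ∃ C₁ ∈ S, ∃ C₂ ∉ S, C₁.asIdeal ∈ minimalPrimes R ∧ C₂.asIdeal ∈ minimalPrimes R ∧
            (n : WithBot ℕ∞) ≤ ringKrullDim (R ⧸ (C₁.asIdeal ⊔ C₂.asIdeal)) :=
  stub_raynaudConnectedness_auxOfSGA2 hG

end Summit.Langlands.Langlands.Cruxes.ReducibleOrdinaryProModular.FineSelmerCodimensionTwo
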